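import Summits.Schanuel.Schanuel.Theorems.SoloInformedRoyAdditiveGelfond
import Summits.Schanuel.Schanuel.Theorems.SoloInformedServedSet
import Summits.Schanuel.Schanuel.Theorems.SoloInformedLemmaAE
import Summits.Schanuel.Schanuel.Theorems.SoloInformedAdditiveCoincidenceRigidity

/-!
# Theorem AE-1, first half: Roy's additive data force roots on an arithmetic progression

Soloist file (informed mode, seat `solo-Schanuel-informed`, s179).  Steps 0–3 of the proof of
the seat's THEOREM AE-1 (`paper/AE-note.md` §7, `η = 0` form) on the node
`RoyAdditiveDirichletExponent` ([cite: Roy2010, Thm 1.1]), assembled in the kernel from the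
tree files: a polynomial `P ∈ RoyAdditiveSmall ξ β σ τ ν n` (non-zero, `deg P ≤ n`,
`H(P) ≤ exp(n^β)`, `|P(cξ)| ≤ exp(-n^ν)` for naturals `c ≤ n^σ`) together with an integer
`1000 ≤ K ≤ n^σ` and five explicit numerical inequalities (all eventually true when
`ν > 4 + β - 4σ`, `K = ⌊n^σ⌋`; that is the second half) yields a set `S' ⊆ [1, K]` of size
`≥ (49/50) K` and `γ, μ ∈ ℂ`, `μ ≠ 0`, such that every `γ + s μ` (`s ∈ S'`) is a ROOT of `P`
within `exp(-n^ν K / (200 n))` of `s ξ`.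

Chain: `soloSS_servedSet_int` (most points `cξ` are served by a private nearby root
`ρ (ι c)`) → `soloAE_lemmaAE` (few inexact additive coincidences among the served roots; the
violations `((a, b), u)` of `SoloInformedAdditiveCoincidenceRigidity` inject into ordered
inexact coincidences `((a + u, a), (b + u, b))`) → `soloAC_affine_off_sparse_of_few_violations`
(THEOREM C: `ρ (ι s) = γ + s • μ` off a sparse set) → `μ ≠ 0` because two served roots near
`aξ ≠ bξ` cannot coincide.

Contents (prefix `soloSR_`): `soloSR_aeval_enum_eq_zero`, `soloSR_natDegree_pos`,
`soloSR_log_mahlerMeasure_le` (`0 ≤ log M(P) ≤ 2 n^β`), `soloSR_budget_le` (the right side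
of Lemma AE is `≤ 9 n³ n^β`), and the main `soloSR_structured_roots`.

What this is NOT.  Not yet THEOREM AE-1 (the cheap dilated factor, Gel'fond's criterion and
the asymptotics are the second half), and nothing here bears on
`Literature.Periods.SchanuelConjecture` (the seat's verdict, no path, is unchanged); the node
itself [cite: Roy2010, Thm 1.1] is not claimed.  Tree files and Mathlib only; no definitions,
no literature hypothesis; axioms the standard three.
-/

namespace Summit.Schanuel.Schanuel.Theorems

open Polynomial Finset

/-- A root enumerated by `ρ` (`univ.val.map ρ = roots of F over ℂ`) is a root of `F`. -/
theorem soloSR_aeval_enum_eq_zero (F : ℤ[X]) (hF : F ≠ 0) {D : ℕ} (ρ : Fin D → ℂ)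
    (hρ : univ.val.map ρ = (F.map (Int.castRingHom ℂ)).roots) (i : Fin D) :
    aeval (ρ i) F = 0 := by
  have hF' : F.map (Int.castRingHom ℂ) ≠ 0 :=
    (Polynomial.map_ne_zero_iff Int.cast_injective).mpr hF
  have hmem : ρ i ∈ (F.map (Int.castRingHom ℂ)).roots := by
    rw [← hρ]
    exact Multiset.mem_map.mpr ⟨i, Finset.mem_val.mpr (Finset.mem_univ i), rfl⟩
  have h := (mem_roots hF').mp hmem
  rwa [IsRoot.def, eval_map_intCastRingHom] at h

/-- A polynomial in `RoyAdditiveSmall ξ β σ τ ν n` (`n ≥ 1`) has positive degree: a non-zero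
constant integer has modulus `≥ 1 > exp(-n^ν)` at the point `0 · ξ`. -/
theorem soloSR_natDegree_pos {ξ : ℂ} {β σ τ ν : ℝ} {n : ℕ} (hn : 1 ≤ n) {P : ℤ[X]}
    (hP : P ∈ RoyAdditiveSmall ξ β σ τ ν n) : 0 < P.natDegree := by
  obtain ⟨hP0, -, -, hsmall⟩ := hP
  have hn0 : (0 : ℝ) < n := by exact_mod_cast hn
  by_contra h
  have h0 : P.natDegree = 0 := by omega
  have hi : ((0 : ℕ) : ℝ) ≤ (n : ℝ) ^ σ := by
    rw [Nat.cast_zero]; exact Real.rpow_nonneg hn0.le σ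
  have hj : ((0 : ℕ) : ℝ) ≤ (n : ℝ) ^ τ := by
    rw [Nat.cast_zero]; exact Real.rpow_nonneg hn0.le τ
  have hv := hsmall 0 0 hi hj
  have hc0 : P.coeff 0 ≠ 0 := by
    intro hc
    apply hP0
    rw [Polynomial.eq_C_of_natDegree_eq_zero h0, hc, C_0]
  rw [hasseDeriv_zero', Polynomial.eq_C_of_natDegree_eq_zero h0, aeval_C, algebraMap_int_eq,
    eq_intCast, Complex.norm_intCast] at hv
  have h1 : (1 : ℝ) ≤ |((P.coeff 0 : ℤ) : ℝ)| := by exact_mod_cast Int.one_le_abs hc0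
  have h2 : Real.exp (-(n : ℝ) ^ ν) < 1 :=
    Real.exp_lt_one_iff.mpr (by linarith [Real.rpow_pos_of_pos hn0 ν])
  linarith

/-- `0 ≤ log M(P) ≤ 2 n^β` for `P ≠ 0` with `deg P ≤ n`, `H(P) ≤ exp(n^β)`, `β ≥ 1`, `n ≥ 1`
(`log M ≤ deg + log ‖P‖_∞`, tree lemma `Polynomial.logMahlerMeasure_map_le`). -/
theorem soloSR_log_mahlerMeasure_le {P : ℤ[X]} (hP0 : P ≠ 0) {n : ℕ} (hn : 1 ≤ n)
    (hdeg : P.natDegree ≤ n) {β : ℝ} (hβ : 1 ≤ β)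
    (hht : (polyHeight P : ℝ) ≤ Real.exp ((n : ℝ) ^ β)) :
    0 ≤ Real.log (P.map (Int.castRingHom ℂ)).mahlerMeasure ∧
      Real.log (P.map (Int.castRingHom ℂ)).mahlerMeasure ≤ 2 * (n : ℝ) ^ β := by
  have hM1 := Polynomial.one_le_mahlerMeasure_of_ne_zero hP0
  refine ⟨Real.log_nonneg hM1, ?_⟩
  have h := Polynomial.logMahlerMeasure_map_le hP0
  rw [Polynomial.logMahlerMeasure_eq_log_MahlerMeasure] at h
  have hsup1 : 1 ≤ P.supNorm := Polynomial.one_le_supNorm_of_ne_zero hP0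
  have hlog : Real.log P.supNorm ≤ (n : ℝ) ^ β := by
    rw [Real.log_le_iff_le_exp (by linarith)]
    exact (supNorm_le_polyHeight P).trans hht
  have hn1 : (1 : ℝ) ≤ n := by exact_mod_cast hn
  have hnβ : (n : ℝ) ≤ (n : ℝ) ^ β := by
    conv_lhs => rw [← Real.rpow_one (n : ℝ)]
    exact Real.rpow_le_rpow_of_exponent_le hn1 hβ
  have hd : (P.natDegree : ℝ) ≤ n := by exact_mod_cast hdeg
  linarith

/-- The right side of Lemma AE for `deg = D ≤ n`, `0 ≤ L ≤ 2 n^β`, `β ≥ 1`, `n ≥ 1`: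
`2D(D-1)² · L + 5 C(D,2)² · log 2 ≤ 9 n³ n^β`. -/
theorem soloSR_budget_le {D n : ℕ} (hDn : D ≤ n) (hn : 1 ≤ n) {β : ℝ} (hβ : 1 ≤ β) {L : ℝ}
    (hL0 : 0 ≤ L) (hL : L ≤ 2 * (n : ℝ) ^ β) :
    ((2 * D * (D - 1) ^ 2 : ℕ) : ℝ) * L + ((5 * (D.choose 2) ^ 2 : ℕ) : ℝ) * Real.log 2 ≤
      9 * ((n : ℝ) ^ 3 * (n : ℝ) ^ β) := by
  have hn1 : (1 : ℝ) ≤ n := by exact_mod_cast hn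
  have hnβ : (n : ℝ) ≤ (n : ℝ) ^ β := by
    conv_lhs => rw [← Real.rpow_one (n : ℝ)]
    exact Real.rpow_le_rpow_of_exponent_le hn1 hβ
  have h1 : ((2 * D * (D - 1) ^ 2 : ℕ) : ℝ) ≤ 2 * (n : ℝ) ^ 3 := by
    have h : 2 * D * (D - 1) ^ 2 ≤ 2 * n ^ 3 := by
      calc 2 * D * (D - 1) ^ 2 ≤ 2 * n * n ^ 2 :=
            Nat.mul_le_mul (Nat.mul_le_mul_left 2 hDn)
              (Nat.pow_le_pow_left (by omega : D - 1 ≤ n) 2)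
        _ = 2 * n ^ 3 := by ring
    exact_mod_cast h
  have h2 : ((5 * (D.choose 2) ^ 2 : ℕ) : ℝ) ≤ 5 * (n : ℝ) ^ 4 := by
    have h : 5 * (D.choose 2) ^ 2 ≤ 5 * n ^ 4 := by
      have hc : D.choose 2 ≤ n ^ 2 := (Nat.choose_le_pow D 2).trans (Nat.pow_le_pow_left hDn 2)
      calc 5 * (D.choose 2) ^ 2 ≤ 5 * (n ^ 2) ^ 2 :=
            Nat.mul_le_mul_left 5 (Nat.pow_le_pow_left hc 2)
        _ = 5 * n ^ 4 := by ring
    exact_mod_cast h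
  have h3 : (n : ℝ) ^ 4 ≤ (n : ℝ) ^ 3 * (n : ℝ) ^ β := by
    rw [pow_succ]
    exact mul_le_mul_of_nonneg_left hnβ (by positivity)
  have hlog2 : Real.log 2 ≤ 1 := by
    have := Real.log_two_lt_d9; norm_num at this; linarith
  have hlog0 : 0 ≤ Real.log 2 := Real.log_nonneg one_le_two
  calc ((2 * D * (D - 1) ^ 2 : ℕ) : ℝ) * L + ((5 * (D.choose 2) ^ 2 : ℕ) : ℝ) * Real.log 2
      ≤ 2 * (n : ℝ) ^ 3 * (2 * (n : ℝ) ^ β) + 5 * (n : ℝ) ^ 4 * 1 :=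
        add_le_add (mul_le_mul h1 hL hL0 (by positivity))
          (mul_le_mul h2 hlog2 hlog0 (by positivity))
    _ ≤ 9 * ((n : ℝ) ^ 3 * (n : ℝ) ^ β) := by nlinarith [h3]

/-- **Structured roots from Roy's additive data (AE-note §7, Steps 0–3, `η = 0`).**
Let `P ∈ RoyAdditiveSmall ξ β σ τ ν n` (`β ≥ 1`, `n ≥ 1`), `1000 ≤ K ≤ n^σ`, `c₁` with
`exp(-c₁) ≤ min(1, ‖ξ‖/2)`, and put `W = n^ν K / (200 n)`, `ε = exp(-W)`.  Assume the
numerical inequalities `2 c₁ n ≤ n^ν`, `ε ≤ 1/2`, `4ε ≤ ‖ξ‖`, `log (8(K‖ξ‖ + 1)) ≤ W/2` and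
`4·10⁷ n⁴ n^β ≤ K⁴ n^ν`.  Then there are `S' ⊆ [1, K]` with `#S' ≥ (49/50) K` and
`γ, μ ∈ ℂ`, `μ ≠ 0`, such that for every `s ∈ S'` the point `γ + s μ` is a root of `P` with
`‖γ + s μ - s ξ‖ ≤ ε`. -/
theorem soloSR_structured_roots {ξ : ℂ} {β σ τ ν : ℝ} (hβ : 1 ≤ β) {n K : ℕ} (hn : 1 ≤ n)
    (hK : 1000 ≤ K) (hKσ : (K : ℝ) ≤ (n : ℝ) ^ σ) {c₁ : ℝ}
    (hc : Real.exp (-c₁) ≤ min 1 (‖ξ‖ / 2)) (h₁ : 2 * c₁ * n ≤ (n : ℝ) ^ ν)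
    (h₂ : Real.exp (-((n : ℝ) ^ ν * K / (200 * n))) ≤ 1 / 2)
    (h₃ : 4 * Real.exp (-((n : ℝ) ^ ν * K / (200 * n))) ≤ ‖ξ‖)
    (h₄ : Real.log (8 * (K * ‖ξ‖ + 1)) ≤ (n : ℝ) ^ ν * K / (400 * n))
    (h₅ : 40000000 * ((n : ℝ) ^ 4 * (n : ℝ) ^ β) ≤ (K : ℝ) ^ 4 * (n : ℝ) ^ ν)
    {P : ℤ[X]} (hP : P ∈ RoyAdditiveSmall ξ β σ τ ν n) :
    ∃ S' : Finset ℕ, S' ⊆ Icc 1 K ∧ (49 : ℝ) / 50 * K ≤ #S' ∧ ∃ γ μ : ℂ, μ ≠ 0 ∧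
      ∀ s ∈ S', aeval (γ + (s : ℂ) * μ) P = 0 ∧
        ‖(γ + (s : ℂ) * μ) - (s : ℂ) * ξ‖ ≤ Real.exp (-((n : ℝ) ^ ν * K / (200 * n))) := by
  classical
  have hD0 : 0 < P.natDegree := soloSR_natDegree_pos hn hP
  obtain ⟨hP0, hdeg, hht, hsmall⟩ := hP
  obtain ⟨ρ, hρ⟩ := soloSI_exists_roots_enum (L := ℂ) P
  have hn0 : (0 : ℝ) < n := by exact_mod_cast hn
  have hK0 : (0 : ℝ) < K := by exact_mod_cast (show 0 < K by omega)
  have hV0 : 0 < (n : ℝ) ^ ν := Real.rpow_pos_of_pos hn0 ν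
  set W : ℝ := (n : ℝ) ^ ν * K / (200 * n) with hW
  have hW0 : 0 < W := by positivity
  have hW2 : (n : ℝ) ^ ν * K / (400 * n) = W / 2 := by rw [hW]; ring
  set ε : ℝ := Real.exp (-W) with hε
  have hε0 : 0 < ε := Real.exp_pos _
  -- Step 1: the served set
  have hc₁0 : 0 ≤ c₁ := by
    have h := (le_min_iff.mp hc).1
    have := Real.exp_le_one_iff.mp h
    linarith
  have hVc : c₁ * n < (n : ℝ) ^ ν := by
    rcases (mul_nonneg hc₁0 hn0.le).eq_or_lt with h | h
    · rw [← h]; exact hV0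
    · linarith
  have hsmall' : ∀ c ∈ Icc 1 K,
      ‖(P.map (Int.castRingHom ℂ)).eval ((c : ℂ) * ξ + 0)‖ ≤ Real.exp (-(n : ℝ) ^ ν) := by
    intro c hc'
    have hcK : c ≤ K := (Finset.mem_Icc.mp hc').2
    have hi : (c : ℝ) ≤ (n : ℝ) ^ σ := le_trans (by exact_mod_cast hcK) hKσ
    have hj : ((0 : ℕ) : ℝ) ≤ (n : ℝ) ^ τ := by
      rw [Nat.cast_zero]; exact Real.rpow_nonneg hn0.le τ
    have h := hsmall c 0 hi hj
    rw [hasseDeriv_zero'] at h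
    rwa [add_zero, eval_map_intCastRingHom]
  obtain ⟨S, hSC, ι, hcardt, hι, hnear, hfar⟩ :=
    soloSS_servedSet_int (N := n) P hP0 ρ hρ hD0 hdeg ξ 0 (Icc 1 K) (100 * n / K) hc hVc hsmall'
  have hrad : Real.exp (-((n : ℝ) ^ ν - c₁ * n) / (100 * n / K)) ≤ ε := by
    rw [hε, Real.exp_le_exp, neg_div, neg_le_neg_iff, le_div_iff₀ (by positivity)]
    have : W * (100 * n / K) = (n : ℝ) ^ ν / 2 := by
      rw [hW]; field_simp; ring
    rw [this]
    linarith
  have hservedε : ∀ s ∈ S, ‖ρ (ι s) - (s * ξ + 0)‖ ≤ ε := fun s hs => (hfar s hs).trans hrad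
  have hSK : ∀ s ∈ S, s ≤ K := fun s hs => (Finset.mem_Icc.mp (hSC hs)).2
  have hE : 100 * #(Icc 1 K \ S) ≤ K := by
    have h : (#(Icc 1 K \ S) : ℝ) * (100 * n / K) ≤ n := hcardt
    rw [← mul_div_assoc, div_le_iff₀ hK0] at h
    have h3 : (100 * (#(Icc 1 K \ S) : ℝ)) * n ≤ K * n := by linarith
    have h4 := le_of_mul_le_mul_right h3 hn0
    exact_mod_cast h4
  -- Step 2: violations of exact additivity inject into inexact coincidences (Lemma AE)
  set Vset : Finset ((ℕ × ℕ) × ℕ) := ((S ×ˢ S) ×ˢ Finset.range (K + 1)).filter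
    (fun x => x.1.1 + x.2 ∈ S ∧ x.1.2 + x.2 ∈ S ∧
      ρ (ι (x.1.1 + x.2)) - ρ (ι x.1.1) ≠ ρ (ι (x.1.2 + x.2)) - ρ (ι x.1.2)) with hVset
  have hVmem : ∀ a ∈ S, ∀ b ∈ S, ∀ u : ℕ, a + u ∈ S → b + u ∈ S →
      (fun s => ρ (ι s)) (a + u) - (fun s => ρ (ι s)) a ≠
        (fun s => ρ (ι s)) (b + u) - (fun s => ρ (ι s)) b → ((a, b), u) ∈ Vset := by
    intro a ha b hb u hau hbu hne
    rw [hVset, Finset.mem_filter]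
    refine ⟨?_, hau, hbu, hne⟩
    simp only [Finset.mem_product, Finset.mem_range]
    exact ⟨⟨ha, hb⟩, by have := hSK _ hau; omega⟩
  have hVset_mem : ∀ x ∈ Vset, x.1.1 ∈ S ∧ x.1.2 ∈ S ∧ x.1.1 + x.2 ∈ S ∧ x.1.2 + x.2 ∈ S ∧
      ρ (ι (x.1.1 + x.2)) - ρ (ι x.1.1) ≠ ρ (ι (x.1.2 + x.2)) - ρ (ι x.1.2) ∧ 0 < x.2 := by
    intro x hx
    rw [hVset, Finset.mem_filter, Finset.mem_product, Finset.mem_product] at hx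
    obtain ⟨⟨⟨ha, hb⟩, -⟩, hau, hbu, hne⟩ := hx
    refine ⟨ha, hb, hau, hbu, hne, Nat.pos_of_ne_zero ?_⟩
    intro hu
    apply hne
    rw [hu, add_zero, add_zero, sub_self, sub_self]
  have hginj : Function.Injective
      (fun x : (ℕ × ℕ) × ℕ => ((x.1.1 + x.2, x.1.1), (x.1.2 + x.2, x.1.2))) := by
    rintro ⟨⟨a, b⟩, u⟩ ⟨⟨a', b'⟩, u'⟩ h
    simp only [Prod.mk.injEq] at h
    obtain ⟨⟨h1, h2⟩, h3, h4⟩ := h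
    subst h2
    subst h4
    have hu : u = u' := by omega
    subst hu
    rfl
  set 𝒞 := Vset.image (fun x : (ℕ × ℕ) × ℕ => ((x.1.1 + x.2, x.1.1), (x.1.2 + x.2, x.1.2)))
    with h𝒞
  have hC𝒞 : #𝒞 = #Vset := Finset.card_image_of_injective _ hginj
  have hAE := soloAE_lemmaAE P hP0 rfl ρ hρ ξ 0 K hε0 h₂ h₃ S hSK ι hι hservedε 𝒞
    (fun c hc => by
      obtain ⟨x, hx, rfl⟩ := Finset.mem_image.mp hc
      obtain ⟨ha, hb, hau, hbu, -, -⟩ := hVset_mem x hx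
      exact ⟨hau, ha, hbu, hb⟩)
    (fun c hc => by
      obtain ⟨x, hx, rfl⟩ := Finset.mem_image.mp hc
      obtain ⟨-, -, -, -, -, hu⟩ := hVset_mem x hx
      exact ⟨by simp only; omega, by simp only; omega⟩)
    (fun c hc => by
      obtain ⟨x, hx, rfl⟩ := Finset.mem_image.mp hc
      simp only; ring)
    (fun c hc => by
      obtain ⟨x, hx, rfl⟩ := Finset.mem_image.mp hc
      obtain ⟨-, -, -, -, hne, -⟩ := hVset_mem x hx
      exact hne)
  -- the numerical budget: `#Vset · W/2 ≤ 9 n³ n^β`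
  have hL : W / 2 ≤ Real.log (1 / (8 * (K * ‖ξ‖ + 1) * ε)) := by
    rw [one_div, Real.log_inv, hε, Real.log_mul (by positivity) (Real.exp_pos _).ne',
      Real.log_exp]
    linarith
  obtain ⟨hlogM0, hlogM⟩ := soloSR_log_mahlerMeasure_le hP0 hn hdeg hβ hht
  have hB := soloSR_budget_le hdeg hn hβ hlogM0 hlogM
  have hVcard : (#Vset : ℝ) * (W / 2) ≤ 9 * ((n : ℝ) ^ 3 * (n : ℝ) ^ β) := by
    rw [← hC𝒞]
    calc (#𝒞 : ℝ) * (W / 2) ≤ #𝒞 * Real.log (1 / (8 * (K * ‖ξ‖ + 1) * ε)) :=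
          mul_le_mul_of_nonneg_left hL (Nat.cast_nonneg _)
      _ ≤ _ := hAE
      _ ≤ 9 * ((n : ℝ) ^ 3 * (n : ℝ) ^ β) := hB
  have hEq : (K : ℝ) ^ 3 * (W / 2) = (K : ℝ) ^ 4 * (n : ℝ) ^ ν / (400 * n) := by
    rw [hW]; field_simp; ring
  have h400 : (0 : ℝ) < 400 * n := by positivity
  have hn4β : (0 : ℝ) ≤ (n : ℝ) ^ 4 * (n : ℝ) ^ β :=
    mul_nonneg (pow_nonneg hn0.le 4) (Real.rpow_nonneg hn0.le β)
  have hVK : 10000 * #Vset ≤ K ^ 3 := by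
    have key : (10000 * #Vset : ℝ) * (W / 2) ≤ (K : ℝ) ^ 3 * (W / 2) := by
      calc (10000 * #Vset : ℝ) * (W / 2) = 10000 * ((#Vset : ℝ) * (W / 2)) := by ring
        _ ≤ 10000 * (9 * ((n : ℝ) ^ 3 * (n : ℝ) ^ β)) :=
            mul_le_mul_of_nonneg_left hVcard (by norm_num)
        _ ≤ (K : ℝ) ^ 3 * (W / 2) := by
            rw [hEq, le_div_iff₀ h400,
              show (10000 : ℝ) * (9 * ((n : ℝ) ^ 3 * (n : ℝ) ^ β)) * (400 * n) =
                36000000 * ((n : ℝ) ^ 4 * (n : ℝ) ^ β) by ring]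
            linarith [h₅, hn4β]
    have h := le_of_mul_le_mul_right key (half_pos hW0)
    exact_mod_cast h
  -- Step 3: Theorem C
  obtain ⟨γ, μ, X, hXcard, haff⟩ :=
    soloAC_affine_off_sparse_of_few_violations hK hSC hE (fun s => ρ (ι s)) hVmem hVK
  have haff' : ∀ s ∈ S, s ∉ X → ρ (ι s) = γ + (s : ℂ) * μ := by
    intro s hs hX
    have h := haff s hs hX
    simp only [nsmul_eq_mul] at h
    exact h
  have hXreal : (100 * #X : ℝ) ≤ K := by
    have h1 : ((K : ℝ) ^ 2 * #X) ≤ 110 * #Vset := by exact_mod_cast hXcard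
    have key : (100 * #X : ℝ) * ((K : ℝ) ^ 2 * (W / 2)) ≤ (K : ℝ) * ((K : ℝ) ^ 2 * (W / 2)) := by
      calc (100 * #X : ℝ) * ((K : ℝ) ^ 2 * (W / 2)) = 100 * (((K : ℝ) ^ 2 * #X) * (W / 2)) := by
            ring
        _ ≤ 100 * ((110 * #Vset) * (W / 2)) := by gcongr
        _ = 11000 * ((#Vset : ℝ) * (W / 2)) := by ring
        _ ≤ 11000 * (9 * ((n : ℝ) ^ 3 * (n : ℝ) ^ β)) :=
            mul_le_mul_of_nonneg_left hVcard (by norm_num)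
        _ ≤ (K : ℝ) * ((K : ℝ) ^ 2 * (W / 2)) := by
            rw [show (K : ℝ) * ((K : ℝ) ^ 2 * (W / 2)) = (K : ℝ) ^ 3 * (W / 2) by ring, hEq,
              le_div_iff₀ h400,
              show (11000 : ℝ) * (9 * ((n : ℝ) ^ 3 * (n : ℝ) ^ β)) * (400 * n) =
                39600000 * ((n : ℝ) ^ 4 * (n : ℝ) ^ β) by ring]
            linarith [h₅, hn4β]
    exact le_of_mul_le_mul_right key (by positivity)
  -- Step 4: the structured set `S' = S \ X`
  set S' := S.filter (fun s => s ∉ X) with hS'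
  have hS'card : (49 : ℝ) / 50 * K ≤ #S' := by
    have e1 : (#(Icc 1 K \ S) : ℝ) + #S = K := by
      have h := Finset.card_sdiff_add_card_eq_card hSC
      rw [Nat.card_Icc] at h
      have h' : #(Icc 1 K \ S) + #S = K := by omega
      exact_mod_cast h'
    have e2 : (#(S.filter (fun s => s ∈ X)) : ℝ) + #S' = #S := by
      exact_mod_cast Finset.card_filter_add_card_filter_not (fun s => s ∈ X)
    have e3 : (#(S.filter (fun s => s ∈ X)) : ℝ) ≤ #X := by
      exact_mod_cast Finset.card_le_card (fun s hs => (Finset.mem_filter.mp hs).2)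
    have e4 : (100 * #(Icc 1 K \ S) : ℝ) ≤ K := by exact_mod_cast hE
    linarith
  have hμ : μ ≠ 0 := by
    intro hμ
    have hK' : (1000 : ℝ) ≤ K := by exact_mod_cast hK
    have h980 : (980 : ℝ) ≤ #S' := by linarith
    have hcard' : 1 < #S' := by
      have : (980 : ℕ) ≤ #S' := by exact_mod_cast h980
      omega
    obtain ⟨a, ha, b, hb, hab⟩ := Finset.one_lt_card.mp hcard'
    have ha' := Finset.mem_filter.mp ha
    have hb' := Finset.mem_filter.mp hb
    have hφa : ρ (ι a) = γ + (a : ℂ) * μ := haff' a ha'.1 ha'.2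
    have hφb : ρ (ι b) = γ + (b : ℂ) * μ := haff' b hb'.1 hb'.2
    rw [hμ, mul_zero, add_zero] at hφa hφb
    have h1 := hnear a ha'.1
    have h2 := hnear b hb'.1
    rw [hφa, add_zero] at h1
    rw [hφb, add_zero] at h2
    have h3 : ‖(a : ℂ) * ξ - (b : ℂ) * ξ‖ < ‖ξ‖ := by
      calc ‖(a : ℂ) * ξ - (b : ℂ) * ξ‖ = ‖(γ - (b : ℂ) * ξ) - (γ - (a : ℂ) * ξ)‖ := by
            congr 1; ring
        _ ≤ ‖γ - (b : ℂ) * ξ‖ + ‖γ - (a : ℂ) * ξ‖ := norm_sub_le _ _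
        _ < ‖ξ‖ / 2 + ‖ξ‖ / 2 := add_lt_add h2 h1
        _ = ‖ξ‖ := by ring
    have h4 : ‖ξ‖ ≤ ‖(a : ℂ) * ξ - (b : ℂ) * ξ‖ := by
      rw [← sub_mul, norm_mul]
      have hab' : (1 : ℝ) ≤ ‖((a : ℂ) - (b : ℂ))‖ := by
        have : ((a : ℂ) - (b : ℂ)) = ((a - b : ℤ) : ℂ) := by push_cast; ring
        rw [this, Complex.norm_intCast]
        have hne : (a : ℤ) - b ≠ 0 := by omega
        exact_mod_cast Int.one_le_abs hne
      exact le_mul_of_one_le_left (norm_nonneg _) hab'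
    linarith
  refine ⟨S', fun s hs => hSC (Finset.mem_filter.mp hs).1, hS'card, γ, μ, hμ, ?_⟩
  intro s hs
  obtain ⟨hsS, hsX⟩ := Finset.mem_filter.mp hs
  have hφs : ρ (ι s) = γ + (s : ℂ) * μ := haff' s hsS hsX
  refine ⟨?_, ?_⟩
  · rw [← hφs]; exact soloSR_aeval_enum_eq_zero P hP0 ρ hρ (ι s)
  · rw [← hφs]
    have h := hservedε s hsS
    rwa [add_zero] at h

end Summit.Schanuel.Schanuel.Theorems
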